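import Literature.AlgebraicGeometry.Resolution.SncStrata
import Literature.AlgebraicGeometry.Resolution.StalkSpecializesLocalization
import Literature.AlgebraicGeometry.Resolution.AlterationsSingularComponentsGlue
import HarnessLib

/-!
# `WildQuotients.SummitReduction` (stmt-ResolutionOfSingularities-16324), line `FramePerfect`, skeleton v8:
# stub `stub_pair_quasiSplitNormalForm` (N) — helper file 8: the components of a `G`-strict strict
# normal crossings divisor through a point, and translates of singular components (topology for
# de Jong 1997, 5.11 ¶2: "as `D` is `G`-strict, `⋃ g(E_α)` is a disjoint union of components `E_β`")

Route `ResolutionOfSingularities/WildQuotients`, crux `SummitReduction`; sub-goals of the registered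
stub `stub_pair_quasiSplitNormalForm` of the line skeleton `Cruxes/SummitReduction/Lines/FramePerfect.lean`
(v8, lead c4). Worker file.

De Jong 1997, p. 619: "by the remarks at the end of [1, 3.5] we have `Sing(X) = ⋃ E_α`, with `E_α`
regular of codimension 3 in `X` mapping isomorphically to an irreducible component of some
`Dᵢ ∩ Dⱼ`. Thus, as `D` is `G`-strict, we have that `⋃_{g ∈ G} g(E_α)` is a disjoint union of
components `E_β`." This file supplies the point-set ingredients of this sentence, phrased with the
primes `𝔭_η ⊆ 𝒪_{Y,y₀}` of the generisations `η ⤳ y₀` (`primeOfSpecializes`, Stacks 01J7):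

* `exists_point_primeOfSpecializes_eq_span`, `mem_closure_iff_primeOfSpecializes_le`,
  `maximal_closure_of_primeOfSpecializes_eq_span` — for a regular system of parameters
  `t₁, …, t_r, …` of `𝒪_{Y,y₀}` with `I(D)_{y₀} = (t₁ ⋯ t_r)`, the prime `(tᵢ)` is `𝔭_{ηᵢ}` for a
  generisation `ηᵢ` of `y₀`, and `Dᵢ = cl{ηᵢ}` is an irreducible component of `D` through `y₀`
  (the component with local equation `tᵢ`), with `ζ ∈ Dᵢ ↔ tᵢ ∈ 𝔭_ζ` for `ζ ⤳ y₀`;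
* `image_mem_of_strict` — `G`-strictness at work: if `C` is a component of `D` through `y₀`,
  `ζ ∈ C` and `σ ζ ⤳ y₀` for an automorphism `σ` respecting strictness, then `σ ζ ∈ C`
  (`C ∩ σ(C) ∋ y₀`, so `σ(C) = C`);
* `comap_stalkMap_primeOfSpecializes` — `(f^#)⁻¹ 𝔭_ξ = 𝔭_{f ξ}`;
* `exists_component_image_eq` — the translate of an irreducible component of the singular locus
  by an automorphism is an irreducible component of the singular locus.
-/

set_option linter.dupNamespace false

noncomputable section

open CategoryTheory CategoryTheory.Limits AlgebraicGeometry TopologicalSpace Topology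
open Literature.AlgebraicGeometry.Resolution
open Literature.AlgebraicGeometry
open IsLocalRing Scheme.IdealSheafData

namespace Summit.ResolutionOfSingularities.ResolutionOfSingularities.Theorems

universe u

/-! ## Generisations and components of `D` through a point -/

section Components

variable {Y : Scheme.{u}} {y₀ : Y}

/-- **The branch `tᵢ = 0` has a generic point**: for a part `t` of a regular system of parameters of
`𝒪_{Y,y₀}`, the prime `(tᵢ)` is `𝔭_η` for a generisation `η ⤳ y₀` (Stacks 01J7).
[cite: StacksProject, Tag 01J7] -/
theorem exists_point_primeOfSpecializes_eq_span {r : ℕ} {t : Fin r → Y.presheaf.stalk y₀}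
    (hz : IsRsopPart t) (i : Fin r) :
    ∃ (η : Y) (h : η ⤳ y₀), primeOfSpecializes h = Ideal.span {t i} := by
  haveI : (Ideal.span {t i}).IsPrime :=
    ((hz.mem_minimalPrimes_span_prod_iff (Ideal.span {t i})).mpr ⟨i, rfl⟩).1.1
  obtain ⟨η, h, hP⟩ := exists_specializes_comap_stalkSpecializes_eq y₀ (Ideal.span {t i})
  exact ⟨η, h, hP.symm⟩

/-- For generisations `η, ζ` of `y₀`: `ζ ∈ cl{η} ↔ 𝔭_η ≤ 𝔭_ζ` (`I(cl{η})_{y₀} = 𝔭_η`,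
Stacks 01J7). [cite: StacksProject, Tag 01J7] -/
theorem mem_closure_iff_primeOfSpecializes_le {η ζ : Y} (hη : η ⤳ y₀) (hζ : ζ ⤳ y₀) :
    ζ ∈ closure ({η} : Set Y) ↔ primeOfSpecializes hη ≤ primeOfSpecializes hζ := by
  rw [← stalkIdeal_vanishingIdeal_closure hη]
  exact mem_iff_stalkIdeal_vanishingIdeal_le (Z := ⟨closure {η}, isClosed_closure⟩) hζ

/-- **`tᵢ ∈ 𝔭_ζ ↔ ζ ∈ Dᵢ = cl{ηᵢ}`** for a generisation `ζ` of `y₀`, where `𝔭_{ηᵢ} = (tᵢ)`.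
[cite: StacksProject, Tag 01J7] -/
theorem mem_closure_iff_mem_primeOfSpecializes {r : ℕ} {t : Fin r → Y.presheaf.stalk y₀}
    {i : Fin r} {η ζ : Y} (hη : η ⤳ y₀) (hηP : primeOfSpecializes hη = Ideal.span {t i})
    (hζ : ζ ⤳ y₀) : ζ ∈ closure ({η} : Set Y) ↔ t i ∈ primeOfSpecializes hζ := by
  rw [mem_closure_iff_primeOfSpecializes_le hη hζ, hηP, Ideal.span_singleton_le_iff_mem]

/-- **`Dᵢ = cl{ηᵢ}` is an irreducible component of `D` through `y₀`** (the component with local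
equation `tᵢ` at `y₀`): for a part `t₁, …, t_r` of a regular system of parameters of `𝒪_{Y,y₀}`
with `I(D)_{y₀} = (t₁ ⋯ t_r)` and `𝔭_{ηᵢ} = (tᵢ)`, the closed irreducible `cl{ηᵢ}` lies in `D`
(`(t₁ ⋯ t_r) ⊆ (tᵢ)`) and is maximal among the irreducible subsets of `D`: a larger one has a
generic point `ω ⤳ ηᵢ` with `(t₁ ⋯ t_r) ⊆ 𝔭_ω ⊆ (tᵢ)`, whence `tⱼ ∈ 𝔭_ω ⊆ (tᵢ)` for some `j`,
`j = i`, and `ω ∈ cl{ηᵢ}`. [cite: DeJong1996, 2.4, p. 55] -/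
theorem maximal_closure_of_primeOfSpecializes_eq_span {D : Set Y} (hDc : IsClosed D) {r : ℕ}
    {t : Fin r → Y.presheaf.stalk y₀} (hz : IsRsopPart t)
    (hI : stalkIdeal (vanishingIdeal ⟨D, hDc⟩) y₀ = Ideal.span {∏ i, t i})
    {i : Fin r} {η : Y} (hη : η ⤳ y₀) (hηP : primeOfSpecializes hη = Ideal.span {t i}) :
    Maximal (fun C : Set Y => IsIrreducible C ∧ C ⊆ D) (closure {η}) := by
  -- `η ∈ D`
  have hηD : η ∈ D := by
    refine mem_of_stalkIdeal_vanishingIdeal_le (Z := ⟨D, hDc⟩) hη ?_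
    rw [hI, hηP, Ideal.span_singleton_le_iff_mem]
    exact Ideal.mem_span_singleton.mpr (Finset.dvd_prod_of_mem t (Finset.mem_univ i))
  refine ⟨⟨isIrreducible_singleton.closure, closure_minimal (Set.singleton_subset_iff.mpr hηD) hDc⟩,
    ?_⟩
  rintro W ⟨hWirr, hWD⟩ hηW
  -- the generic point `ω` of `cl W`
  set ω := hWirr.genericPoint with hω
  have hωgen : IsGenericPoint ω (closure W) := hWirr.isGenericPoint_genericPoint_closure
  have hηW' : η ∈ closure W := hηW.trans subset_closure (subset_closure (Set.mem_singleton η))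
  have hωη : ω ⤳ η := hωgen.specializes hηW'
  have hωy : ω ⤳ y₀ := hωη.trans hη
  have hωD : ω ∈ D := (closure_minimal hWD hDc) hωgen.mem
  -- `(t₁ ⋯ t_r) ⊆ 𝔭_ω ⊆ 𝔭_η = (tᵢ)`
  have h1 : stalkIdeal (vanishingIdeal ⟨D, hDc⟩) y₀ ≤ primeOfSpecializes hωy :=
    stalkIdeal_vanishingIdeal_le (Z := ⟨D, hDc⟩) hωy hωD
  have h2 : primeOfSpecializes hωy ≤ primeOfSpecializes hη :=
    primeOfSpecializes_le_of_specializes hη hωy hωη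
  have hprod : ∏ j, t j ∈ primeOfSpecializes hωy := by
    apply h1
    rw [hI]
    exact Ideal.mem_span_singleton_self _
  haveI : (primeOfSpecializes hωy).IsPrime := Ideal.IsPrime.comap _
  obtain ⟨j, -, hj⟩ := Ideal.IsPrime.prod_mem_iff.mp hprod
  -- `tⱼ ∈ (tᵢ)` forces `j = i`
  have hji : j = i := by
    by_contra hne
    have hjmem : t j ∈ Ideal.span {t i} := hηP ▸ h2 hj
    refine hz.not_mem_span_image (S := {i}) (i := j) (by simpa using hne) ?_
    rwa [Set.image_singleton]
  subst hji
  -- so `ω ∈ cl{η}` and `W ⊆ cl W = cl{ω} ⊆ cl{η}`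
  have hωmem : ω ∈ closure ({η} : Set Y) :=
    (mem_closure_iff_mem_primeOfSpecializes hη hηP hωy).mpr hj
  calc W ⊆ closure W := subset_closure
    _ = closure {ω} := hωgen.def.symm
    _ ⊆ closure {η} := closure_minimal (Set.singleton_subset_iff.mpr hωmem) isClosed_closure

/-- The point `y₀` lies on every `Dᵢ = cl{ηᵢ}`: this is Mathlib's `Specializes.mem_closure`
(deprecated duplicate kept as an alias, dedup-02963). [folklore] -/
@[deprecated Specializes.mem_closure (since := "2026-08-17")]
alias mem_closure_of_specializes := Specializes.mem_closure

/-- **`G`-strictness at work** (de Jong 1996, 7.1: a component `C` of `D` with `C ∩ σ(C) ≠ ∅` has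
`σ(C) = C`): if `C` is a component of `D` through `y₀`, closed, `ζ ∈ C`, and `σ ζ` specialises to
`y₀` for an automorphism `σ` of `Y` satisfying the strictness condition, then `σ ζ ∈ C` — indeed
`y₀ ∈ cl{σ ζ} ⊆ σ(C)`, so `C ∩ σ(C) ∋ y₀` and `σ(C) = C`. [cite: DeJong1996, 7.1, p. 87]
[cite: DeJong1997, proof of Prop. 5.11, p. 619] -/
theorem image_mem_of_strict {D : Set Y} (σ : Y ≅ Y)
    (hstrict : ∀ C : Set Y, Maximal (fun C : Set Y => IsIrreducible C ∧ C ⊆ D) C →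
      (C ∩ σ.hom.base '' C).Nonempty → σ.hom.base '' C = C)
    {C : Set Y} (hC : Maximal (fun C : Set Y => IsIrreducible C ∧ C ⊆ D) C) (hCc : IsClosed C)
    (hy₀ : y₀ ∈ C) {ζ : Y} (hζC : ζ ∈ C) (hζ' : σ.hom.base ζ ⤳ y₀) : σ.hom.base ζ ∈ C := by
  have himc : IsClosed (σ.hom.base '' C) := by
    have := (Scheme.homeoOfIso σ).isClosedMap _ hCc
    exact this
  have hy₀' : y₀ ∈ σ.hom.base '' C := by
    have h1 : y₀ ∈ closure ({σ.hom.base ζ} : Set Y) := specializes_iff_mem_closure.mp hζ'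
    have hmem : σ.hom.base ζ ∈ σ.hom.base '' C := ⟨ζ, hζC, rfl⟩
    exact (closure_minimal (Set.singleton_subset_iff.mpr hmem) himc) h1
  have hne : (C ∩ σ.hom.base '' C).Nonempty := ⟨y₀, hy₀, hy₀'⟩
  have heq : σ.hom.base '' C = C := hstrict C hC hne
  rw [← heq]
  exact ⟨ζ, hζC, rfl⟩

end Components

/-! ## Naturality of `𝔭_ξ` -/

/-- **`(f^#_x)⁻¹ 𝔭_ξ = 𝔭_{f ξ}`** for `ξ ⤳ x`: the prime of the generisation `f ξ ⤳ f x` is the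
contraction of the prime of `ξ` (naturality of the specialisation maps of stalks). [folklore] -/
theorem comap_stalkMap_primeOfSpecializes {X Y : Scheme.{u}} (f : X ⟶ Y) {ξ x : X} (h : ξ ⤳ x) :
    (primeOfSpecializes h).comap (f.stalkMap x).hom =
      primeOfSpecializes (f.base.hom.map_specializes h) := by
  change ((maximalIdeal _).comap (X.presheaf.stalkSpecializes h).hom).comap (f.stalkMap x).hom =
    (maximalIdeal _).comap (Y.presheaf.stalkSpecializes (f.base.hom.map_specializes h)).hom
  rw [← IsLocalRing.maximalIdeal_comap (f.stalkMap ξ).hom, Ideal.comap_comap, Ideal.comap_comap,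
    ← CommRingCat.hom_comp, ← CommRingCat.hom_comp, Scheme.Hom.stalkSpecializes_stalkMap]

/-! ## Translates of singular components -/

/-- **The translate of an irreducible component of the singular locus by an automorphism is an
irreducible component of the singular locus**: an automorphism `σ` of `X` induces a homeomorphism
of the subspace `Sing X = {x | 𝒪_{X,x} not regular}` (the stalks at `x` and `σ x` are isomorphic),
and homeomorphisms permute irreducible components. [folklore] -/
theorem exists_component_image_eq {X : Scheme.{u}} (σ : X ≅ X)
    {E : Set ↥({x : X | ¬ IsRegularLocalRing (X.presheaf.stalk x)} : Set X)}
    (hE : E ∈ irreducibleComponents ↥({x : X | ¬ IsRegularLocalRing (X.presheaf.stalk x)} : Set X)) :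
    ∃ E' ∈ irreducibleComponents ↥({x : X | ¬ IsRegularLocalRing (X.presheaf.stalk x)} : Set X),
      Subtype.val '' E' = σ.hom.base '' (Subtype.val '' E) := by
  -- the induced homeomorphism of `Sing X`
  have hiff : ∀ x : X, x ∈ ({x : X | ¬ IsRegularLocalRing (X.presheaf.stalk x)} : Set X) ↔
      (Scheme.homeoOfIso σ) x ∈ ({x : X | ¬ IsRegularLocalRing (X.presheaf.stalk x)} : Set X) := by
    intro x
    simp only [Set.mem_setOf_eq, Scheme.homeoOfIso_apply, not_iff_not]
    have i := (asIso (σ.hom.stalkMap x)).commRingCatIsoToRingEquiv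
    exact ⟨fun h => IsRegularLocalRing.of_ringEquiv i.symm, fun h => IsRegularLocalRing.of_ringEquiv i⟩
  let φ : ↥({x : X | ¬ IsRegularLocalRing (X.presheaf.stalk x)} : Set X) ≃ₜ
      ↥({x : X | ¬ IsRegularLocalRing (X.presheaf.stalk x)} : Set X) :=
    (Scheme.homeoOfIso σ).subtype hiff
  refine ⟨φ.symm ⁻¹' E, ?_, ?_⟩
  · refine preimage_mem_irreducibleComponents hE φ.symm.isOpenEmbedding ?_
    rw [φ.symm.range_coe, Set.inter_univ]
    exact hE.1.1
  · rw [← φ.image_eq_preimage_symm, Set.image_image, Set.image_image]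
    rfl

end Summit.ResolutionOfSingularities.ResolutionOfSingularities.Theorems

end
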